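import Summits.QuantumFields.YangMills.Theorems.LuscherReductionTwistedTraceScalingBOCentralRatesTwo
import HarnessLib

/-!
# Record numerology of the orbit-distance windows of the `(C2)`-moments core bound

Support file for the crux `NearFlatRatioLaw` (line `ratepack_v2`, stub `stub_hODpot_A`, step (R4-prep) of
`Cruxes/NearFlatRatioLaw/Lines/ratepack-v7-moments-g18.md`).

The hypotheses of `…CoreDefectOrbitMomentSq.defect_core_sq_integral_le_orbit_moments` on the windows and the schedule —
`d_O ≤ 1/2`, `d_O + d_I ≤ 1`, `8|P₁|L³(d_O² + d_I²) < 2`, `R_in² + R² + |Λ|T² ≤ 1/900`, and the transport smallness `hH1` — hold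
eventually for the record schedule: `d_O = D·β^{-s}`, `d_I = 14β^{-s}`, `R = r_f(β) = min(1/40, β^{-1/2}ℓ)`, `R_in = r_f/12`,
`T = 9L·5β^{-1/2}ℓ² + β^{-1}`, `Γ = β^{-1}|Λ|`, `c₂ = K(β + β√β/2)` (`ℓ = btLog β`).  Every left side is `O(β^{-s}ℓ⁴ + β^{-1/2}ℓ⁸)`:
`eventually_orbit_window_numerology`.
-/

noncomputable section

open MeasureTheory Filter Topology Real
open scoped BigOperators
open Literature.MathematicalPhysics.QuantumFieldTheory
open Literature.MathematicalPhysics.QuantumLattice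

namespace Summit.QuantumFields.YangMills.Theorems.FemtoTransferGap.TwoLattice.ConstTube

open Summit.QuantumFields.YangMills.Theorems.FemtoTransferGap
open Summit.QuantumFields.YangMills.Theorems.FemtoTransferGap.TwoLattice

variable {L : ℕ} [NeZero L]

omit [NeZero L] in
/-- `√β · β^{-1/2} = 1` for `β ≥ 1`. [folklore] -/
theorem sqrt_mul_powScale_half {β : ℝ} (hβ : 1 ≤ β) : Real.sqrt β * powScale (1 / 2) β = 1 := by
  have h0 : 0 ≤ Real.sqrt β * powScale (1 / 2) β := mul_nonneg (Real.sqrt_nonneg _) (powScale_pos _ _).le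
  have h2 : (Real.sqrt β * powScale (1 / 2) β) ^ 2 = 1 := by
    rw [mul_pow, Real.sq_sqrt (by linarith), mul_powScale_half_sq hβ]
  nlinarith [h0, h2]

/-- The schedule sum `S₀ = (r_f/12)² + r_f² + |Λ|T²` is `≤ C_S·β^{-1}ℓ⁴`, `C_S = 2 + |Λ|(45L+1)²` (`β ≥ 1`). [folklore] -/
theorem schedS0_le {β : ℝ} (hβ : 1 ≤ β) :
    (min (1 / 40) (powScale (1 / 2) β * btLog β) / 12) ^ 2 + (min (1 / 40) (powScale (1 / 2) β * btLog β)) ^ 2 +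
        (Fintype.card (Site 3 L) : ℝ) * (9 * (L : ℝ) * (5 * (powScale (1 / 2) β * btLog β ^ 2)) + powScale 1 β) ^ 2 ≤
      (2 + (Fintype.card (Site 3 L) : ℝ) * (45 * (L : ℝ) + 1) ^ 2) * (powScale (1 / 2) β ^ 2 * btLog β ^ 4) := by
  have hℓ := one_le_btLog β
  have hx0 : 0 < powScale (1 / 2) β := powScale_pos _ _
  have hr0 : 0 ≤ min (1 / 40) (powScale (1 / 2) β * btLog β) := le_min (by norm_num) (mul_nonneg hx0.le (by linarith))
  have hr : min (1 / 40) (powScale (1 / 2) β * btLog β) ≤ powScale (1 / 2) β * btLog β := min_le_right _ _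
  have hT := schedT_le (L := L) hβ
  have hT0 : 0 ≤ 9 * (L : ℝ) * (5 * (powScale (1 / 2) β * btLog β ^ 2)) + powScale 1 β := by
    have := powScale_pos 1 β; have : (0 : ℝ) ≤ (L : ℝ) := Nat.cast_nonneg L; positivity
  have h1 : (min (1 / 40) (powScale (1 / 2) β * btLog β)) ^ 2 ≤ powScale (1 / 2) β ^ 2 * btLog β ^ 4 := by
    calc (min (1 / 40) (powScale (1 / 2) β * btLog β)) ^ 2 ≤ (powScale (1 / 2) β * btLog β) ^ 2 := pow_le_pow_left₀ hr0 hr 2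
      _ = powScale (1 / 2) β ^ 2 * btLog β ^ 2 * 1 := by ring
      _ ≤ powScale (1 / 2) β ^ 2 * btLog β ^ 2 * btLog β ^ 2 := mul_le_mul_of_nonneg_left (one_le_pow₀ hℓ) (by positivity)
      _ = powScale (1 / 2) β ^ 2 * btLog β ^ 4 := by ring
  have h2 : (9 * (L : ℝ) * (5 * (powScale (1 / 2) β * btLog β ^ 2)) + powScale 1 β) ^ 2 ≤ (45 * (L : ℝ) + 1) ^ 2 * (powScale (1 / 2) β ^ 2 * btLog β ^ 4) := by
    calc (9 * (L : ℝ) * (5 * (powScale (1 / 2) β * btLog β ^ 2)) + powScale 1 β) ^ 2 ≤ ((45 * (L : ℝ) + 1) * (powScale (1 / 2) β * btLog β ^ 2)) ^ 2 :=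
          pow_le_pow_left₀ hT0 hT 2
      _ = (45 * (L : ℝ) + 1) ^ 2 * (powScale (1 / 2) β ^ 2 * btLog β ^ 4) := by ring
  have h3 := mul_le_mul_of_nonneg_left h2 (Nat.cast_nonneg (Fintype.card (Site 3 L)))
  have h4 : (min (1 / 40) (powScale (1 / 2) β * btLog β) / 12) ^ 2 ≤ powScale (1 / 2) β ^ 2 * btLog β ^ 4 := by
    rw [div_pow]; exact (div_le_self (sq_nonneg _) (by norm_num)).trans h1
  nlinarith [h1, h3, h4]

set_option maxHeartbeats 800000 in
-- eight eventual facts combined; the final polynomial bookkeeping is large.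
/-- ★★★ **THE RECORD NUMEROLOGY OF THE ORBIT WINDOWS** (see the module docstring): for `0 < s` and `D ≥ 0`, eventually in `β`
all window / schedule hypotheses of `defect_core_sq_integral_le_orbit_moments` hold for the record data. [folklore] -/
theorem eventually_orbit_window_numerology {s : ℝ} (hs : 0 < s) {D : ℝ} (hD : 0 ≤ D) :
    ∀ᶠ β : ℝ in atTop,
      D * powScale s β ≤ 1 / 2 ∧ D * powScale s β + 14 * powScale s β ≤ 1 ∧
      8 * (Fintype.card (Plaquette 3 1) : ℝ) * (L : ℝ) ^ 3 * ((D * powScale s β) ^ 2 + (14 * powScale s β) ^ 2) < 2 ∧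
      (min (1 / 40) (powScale (1 / 2) β * btLog β) / 12) ^ 2 + (min (1 / 40) (powScale (1 / 2) β * btLog β)) ^ 2 +
          (Fintype.card (Site 3 L) : ℝ) * (9 * (L : ℝ) * (5 * (powScale (1 / 2) β * btLog β ^ 2)) + powScale 1 β) ^ 2 ≤ 1 / 900 ∧
      216 * β * (D * powScale s β + 14 * powScale s β) * (D * powScale s β) * (powScale 1 β * Fintype.card (Site 3 L)) +
          300000000 * ((Fintype.card (Edge 3 L) : ℝ) + (Fintype.card (Plaquette 3 L × Fin 3) : ℝ) + (Fintype.card (Plaquette 3 L) : ℝ)) *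
              (β * ((4 + Real.sqrt (8 * (Fintype.card (Plaquette 3 1) : ℝ) * (L : ℝ) ^ 3)) * (D * powScale s β + 14 * powScale s β)) + Real.sqrt β / 2) *
            ((min (1 / 40) (powScale (1 / 2) β * btLog β) / 12) ^ 2 + (min (1 / 40) (powScale (1 / 2) β * btLog β)) ^ 2 +
              (Fintype.card (Site 3 L) : ℝ) * (9 * (L : ℝ) * (5 * (powScale (1 / 2) β * btLog β ^ 2)) + powScale 1 β) ^ 2) +
          300000000 * ((Fintype.card (Edge 3 L) : ℝ) + (Fintype.card (Plaquette 3 L × Fin 3) : ℝ) + (Fintype.card (Plaquette 3 L) : ℝ)) * (β + β * Real.sqrt β / 2) *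
            ((min (1 / 40) (powScale (1 / 2) β * btLog β) / 12) ^ 2 + (min (1 / 40) (powScale (1 / 2) β * btLog β)) ^ 2 +
              (Fintype.card (Site 3 L) : ℝ) * (9 * (L : ℝ) * (5 * (powScale (1 / 2) β * btLog β ^ 2)) + powScale 1 β) ^ 2) ^ 2 ≤ 1 := by
  -- names
  obtain ⟨K, hK⟩ : ∃ K : ℝ, K = 300000000 * ((Fintype.card (Edge 3 L) : ℝ) + (Fintype.card (Plaquette 3 L × Fin 3) : ℝ) + (Fintype.card (Plaquette 3 L) : ℝ)) := ⟨_, rfl⟩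
  obtain ⟨AL, hAL⟩ : ∃ AL : ℝ, AL = 4 + Real.sqrt (8 * (Fintype.card (Plaquette 3 1) : ℝ) * (L : ℝ) ^ 3) := ⟨_, rfl⟩
  obtain ⟨N, hN⟩ : ∃ N : ℝ, N = (Fintype.card (Site 3 L) : ℝ) := ⟨_, rfl⟩
  obtain ⟨CS, hCS⟩ : ∃ CS : ℝ, CS = 2 + (Fintype.card (Site 3 L) : ℝ) * (45 * (L : ℝ) + 1) ^ 2 := ⟨_, rfl⟩
  rw [← hK, ← hAL, ← hN]
  have hK0 : 0 ≤ K := by rw [hK]; positivity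
  have hAL0 : 0 ≤ AL := by rw [hAL]; positivity
  have hN0 : 0 ≤ N := by rw [hN]; positivity
  have hCS0 : 0 ≤ CS := by rw [hCS]; positivity
  -- the elementary eventual facts
  have e1 : ∀ᶠ β : ℝ in atTop, D * powScale s β ≤ 1 / 2 := eventually_mul_le_of_tendsto (tendsto_powScale (σ := s) hs) D (by norm_num)
  have e2 : ∀ᶠ β : ℝ in atTop, (D + 14) * powScale s β ≤ 1 := eventually_mul_le_of_tendsto (tendsto_powScale (σ := s) hs) (D + 14) one_pos
  have e3 : ∀ᶠ β : ℝ in atTop, (8 * (Fintype.card (Plaquette 3 1) : ℝ) * (L : ℝ) ^ 3 * (D ^ 2 + 14 ^ 2)) * powScale s β < 2 :=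
    eventually_mul_lt_of_tendsto (tendsto_powScale (σ := s) hs) _ two_pos
  -- the schedule sum `S₀ ≤ CS·x²ℓ⁴` and the three decays `x²ℓ⁴ → 0`, `β^{-s}ℓ⁴ → 0`, `xℓ⁸ → 0`
  have t1 : Tendsto (fun β : ℝ => powScale (1 / 2) β * btLog β ^ 4) atTop (𝓝 0) := tendsto_powScale_mul_btLog_pow (by norm_num) 4
  have t2 : Tendsto (fun β : ℝ => powScale s β * btLog β ^ 4) atTop (𝓝 0) := tendsto_powScale_mul_btLog_pow hs 4
  have t3 : Tendsto (fun β : ℝ => powScale (1 / 2) β * btLog β ^ 8) atTop (𝓝 0) := tendsto_powScale_mul_btLog_pow (by norm_num) 8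
  have t0 : Tendsto (fun β : ℝ => powScale s β) atTop (𝓝 0) := tendsto_powScale (σ := s) hs
  have e4 : ∀ᶠ β : ℝ in atTop, CS * (powScale (1 / 2) β * btLog β ^ 4) < 1 / 900 := eventually_mul_lt_of_tendsto t1 CS (by norm_num)
  have e5 : ∀ᶠ β : ℝ in atTop, (216 * N * (D + 14) * D) * powScale s β < 1 / 3 := eventually_mul_lt_of_tendsto t0 _ (by norm_num)
  have e6 : ∀ᶠ β : ℝ in atTop, (K * CS * (AL * (D + 14))) * (powScale s β * btLog β ^ 4) < 1 / 6 := eventually_mul_lt_of_tendsto t2 _ (by norm_num)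
  have e7 : ∀ᶠ β : ℝ in atTop, (K * CS / 2) * (powScale (1 / 2) β * btLog β ^ 4) < 1 / 6 := eventually_mul_lt_of_tendsto t1 _ (by norm_num)
  have e8 : ∀ᶠ β : ℝ in atTop, (K * CS ^ 2 * (3 / 2)) * (powScale (1 / 2) β * btLog β ^ 8) < 1 / 3 := eventually_mul_lt_of_tendsto t3 _ (by norm_num)
  filter_upwards [e1, e2, e3, e4, e5, e6, e7, e8, eventually_ge_atTop (1 : ℝ)] with β h1 h2 h3 h4 h5 h6 h7 h8 hβ
  have hps0 : 0 < powScale s β := powScale_pos _ _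
  have hps1 : powScale s β ≤ 1 := powScale_le_one hs.le β
  have hx0 : 0 < powScale (1 / 2) β := powScale_pos _ _
  have hx1 : powScale (1 / 2) β ≤ 1 := powScale_le_one (by norm_num) β
  have hℓ := one_le_btLog β
  have hβ0 : (0 : ℝ) ≤ β := by linarith
  have hxx : β * powScale (1 / 2) β ^ 2 = 1 := mul_powScale_half_sq hβ
  have hb1 : β * powScale 1 β = 1 := mul_powScale_one hβ
  have hsx : Real.sqrt β * powScale (1 / 2) β = 1 := sqrt_mul_powScale_half hβ
  -- abbreviate the schedule sum
  obtain ⟨S₀, hS₀⟩ : ∃ S₀ : ℝ, S₀ = (min (1 / 40) (powScale (1 / 2) β * btLog β) / 12) ^ 2 + (min (1 / 40) (powScale (1 / 2) β * btLog β)) ^ 2 +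
      N * (9 * (L : ℝ) * (5 * (powScale (1 / 2) β * btLog β ^ 2)) + powScale 1 β) ^ 2 := ⟨_, rfl⟩
  rw [← hS₀]
  have hS₀0 : 0 ≤ S₀ := by rw [hS₀]; positivity
  have hS₀b : S₀ ≤ CS * (powScale (1 / 2) β ^ 2 * btLog β ^ 4) := by rw [hS₀, hCS, hN]; exact schedS0_le (L := L) hβ
  have hℓ4 : 0 ≤ btLog β ^ 4 := by positivity
  have hx2 : powScale (1 / 2) β ^ 2 ≤ powScale (1 / 2) β := by nlinarith
  have hS₀b' : S₀ ≤ CS * (powScale (1 / 2) β * btLog β ^ 4) :=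
    hS₀b.trans (mul_le_mul_of_nonneg_left (mul_le_mul_of_nonneg_right hx2 hℓ4) hCS0)
  -- `β S₀ ≤ CS ℓ⁴`, `√β S₀ ≤ CS x ℓ⁴`
  have hβS : β * S₀ ≤ CS * btLog β ^ 4 := by
    calc β * S₀ ≤ β * (CS * (powScale (1 / 2) β ^ 2 * btLog β ^ 4)) := mul_le_mul_of_nonneg_left hS₀b hβ0
      _ = CS * btLog β ^ 4 * (β * powScale (1 / 2) β ^ 2) := by ring
      _ = CS * btLog β ^ 4 := by rw [hxx, mul_one]
  have hrS : Real.sqrt β * S₀ ≤ CS * (powScale (1 / 2) β * btLog β ^ 4) := by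
    calc Real.sqrt β * S₀ ≤ Real.sqrt β * (CS * (powScale (1 / 2) β ^ 2 * btLog β ^ 4)) := mul_le_mul_of_nonneg_left hS₀b (Real.sqrt_nonneg _)
      _ = CS * (powScale (1 / 2) β * btLog β ^ 4) * (Real.sqrt β * powScale (1 / 2) β) := by ring
      _ = CS * (powScale (1 / 2) β * btLog β ^ 4) := by rw [hsx, mul_one]
  refine ⟨h1, by linarith, ?_, ?_, ?_⟩
  · -- the window action bound
    have e : 8 * (Fintype.card (Plaquette 3 1) : ℝ) * (L : ℝ) ^ 3 * ((D * powScale s β) ^ 2 + (14 * powScale s β) ^ 2) =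
        (8 * (Fintype.card (Plaquette 3 1) : ℝ) * (L : ℝ) ^ 3 * (D ^ 2 + 14 ^ 2)) * powScale s β * powScale s β := by ring
    rw [e]
    have h0 : 0 ≤ (8 * (Fintype.card (Plaquette 3 1) : ℝ) * (L : ℝ) ^ 3 * (D ^ 2 + 14 ^ 2)) * powScale s β := by positivity
    have h1' := mul_le_mul_of_nonneg_left hps1 h0
    rw [mul_one] at h1'
    exact h1'.trans_lt h3
  · exact hS₀b'.trans h4.le
  · -- the transport smallness `hH1`: three terms, each `< 1/3`
    have hT1 : 216 * β * (D * powScale s β + 14 * powScale s β) * (D * powScale s β) * (powScale 1 β * N) ≤ 1 / 3 := by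
      have e : 216 * β * (D * powScale s β + 14 * powScale s β) * (D * powScale s β) * (powScale 1 β * N) =
          (216 * N * (D + 14) * D) * powScale s β * powScale s β * (β * powScale 1 β) := by ring
      rw [e, hb1, mul_one]
      have h0 : 0 ≤ (216 * N * (D + 14) * D) * powScale s β := by positivity
      have h1' : (216 * N * (D + 14) * D) * powScale s β * powScale s β ≤ (216 * N * (D + 14) * D) * powScale s β * 1 := mul_le_mul_of_nonneg_left hps1 h0
      linarith
    have hT2 : K * (β * (AL * (D * powScale s β + 14 * powScale s β)) + Real.sqrt β / 2) * S₀ ≤ 1 / 3 := by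
      have e : K * (β * (AL * (D * powScale s β + 14 * powScale s β)) + Real.sqrt β / 2) * S₀ =
          K * (AL * (D + 14)) * powScale s β * (β * S₀) + K / 2 * (Real.sqrt β * S₀) := by ring
      rw [e]
      have ha : K * (AL * (D + 14)) * powScale s β * (β * S₀) ≤ K * (AL * (D + 14)) * powScale s β * (CS * btLog β ^ 4) :=
        mul_le_mul_of_nonneg_left hβS (by positivity)
      have hb : K / 2 * (Real.sqrt β * S₀) ≤ K / 2 * (CS * (powScale (1 / 2) β * btLog β ^ 4)) := mul_le_mul_of_nonneg_left hrS (by positivity)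
      have ea : K * (AL * (D + 14)) * powScale s β * (CS * btLog β ^ 4) = (K * CS * (AL * (D + 14))) * (powScale s β * btLog β ^ 4) := by ring
      have eb : K / 2 * (CS * (powScale (1 / 2) β * btLog β ^ 4)) = (K * CS / 2) * (powScale (1 / 2) β * btLog β ^ 4) := by ring
      linarith
    have hT3 : K * (β + β * Real.sqrt β / 2) * S₀ ^ 2 ≤ 1 / 3 := by
      have e : K * (β + β * Real.sqrt β / 2) * S₀ ^ 2 = K * (β * S₀) * S₀ + K / 2 * (β * S₀) * (Real.sqrt β * S₀) := by ring
      rw [e]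
      have ha : K * (β * S₀) * S₀ ≤ K * (CS * btLog β ^ 4) * (CS * (powScale (1 / 2) β ^ 2 * btLog β ^ 4)) :=
        mul_le_mul (mul_le_mul_of_nonneg_left hβS hK0) hS₀b hS₀0 (by positivity)
      have hb : K / 2 * (β * S₀) * (Real.sqrt β * S₀) ≤ K / 2 * (CS * btLog β ^ 4) * (CS * (powScale (1 / 2) β * btLog β ^ 4)) :=
        mul_le_mul (mul_le_mul_of_nonneg_left hβS (by positivity)) hrS (mul_nonneg (Real.sqrt_nonneg _) hS₀0) (by positivity)
      have hc : K * (CS * btLog β ^ 4) * (CS * (powScale (1 / 2) β ^ 2 * btLog β ^ 4)) ≤ K * CS ^ 2 * (powScale (1 / 2) β * btLog β ^ 8) := by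
        have := mul_le_mul_of_nonneg_left hx2 (by positivity : 0 ≤ K * CS ^ 2 * btLog β ^ 8)
        nlinarith
      have ed : K / 2 * (CS * btLog β ^ 4) * (CS * (powScale (1 / 2) β * btLog β ^ 4)) = K * CS ^ 2 * (powScale (1 / 2) β * btLog β ^ 8) / 2 := by ring
      nlinarith
    linarith

end Summit.QuantumFields.YangMills.Theorems.FemtoTransferGap.TwoLattice.ConstTube

end
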